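import Literature.Analysis.FluidPDE.RieszPressureL3
import Literature.Analysis.FluidPDE.NormalisedPressurePV
import Literature.Analysis.FluidPDE.PressureEquationSlicing
import Literature.Analysis.FluidPDE.DivCurlAnnihilator
import Literature.Analysis.FluidPDE.LocalPressureFarFieldTools
import HarnessLib

/-!
# Locality of the Riesz-transform pressure: uniqueness, additivity over disjoint supports,
# and the far-field integral representation

Analysis/FluidPDE support file (theorems only, no definitions, no named facts) on the discharge
path of the named fact `Literature.Analysis.FluidPDE.RRS2016.lemma15_12`
(`CKNLocalRegularityRRS.lean`: Robinson–Rodrigo–Sadowski 2016, Lemma 15.12, the local pressure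
estimate). The printed proof (pp. 232–233) splits the Calderón–Zygmund part of the pressure as
`p₁ = p₁,₁ + p₁,₂` according to `|y| < 2r` and `|y| > 2r`, bounds `p₁,₁ = Tᵢⱼ(1_{B_{2r}} uᵢuⱼ)`
by the Calderón–Zygmund theorem and the far part `p₁,₂(x) = ∫_{|y|>2r} [∂ᵢ∂ⱼ Γ(x-y)] uᵢuⱼ dy`
through its kernel, `|∇p₁,₂(x)| ≤ c ∫_{|y|>2r} |u|²/|x-y|⁴ dy` ((15.34)–(15.35)). In the tree the
whole-space pressure of an `L³` field is the Riesz pressure `Π[w] = rieszPressure w`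
(`RieszPressureL3`: `L³ → L^{3/2}` continuous, weak Poisson equation `∫ Π[w] Δφ = -∫ D²φ(w,w)`),
and the two manipulations of the printed proof become:

* `ae_eq_zero_of_memLp_of_forall_integral_mul_laplacian_eq_zero` — **Weyl–Liouville for
  scalar `L^q` functions**, `1 < q < ∞` (from the tree's vector-valued
  `ae_eq_zero_of_forall_integral_laplacian_mul_inner_eq_zero`);
* `ae_eq_rieszPressure_of_forall_integral_mul_laplacian` — **uniqueness**: an `L^{3/2}` solution
  of the weak Poisson equation of `w ∈ L³` is a.e. `Π[w]`;
* `rieszPressure_add_ae_eq_of_disjoint` — **additivity over disjoint supports**: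
  `Π[U] = Π[U₁] + Π[U₂]` a.e. when `U = U₁ + U₂` a.e. and `U₁ U₂` have pointwise disjoint
  supports (the tensor `U ⊗ U` splits);
* `hasPressurePV_of_eqOn_ball`, `normalisedPressure_eq_integral_of_eqOn_ball` — for a continuous
  finite-energy field vanishing on a ball about `x`, the principal value is the honest integral,
  `p̃[w](x) = ∫ K(x-y)(w y) dy`;
* `tendsto_integral_pressureKernel_of_tendsto_eLpNorm_three` — the kernel integrals at such an
  `x` pass to `L³` limits (three-factor Hölder);
* `rieszPressure_ae_eq_integral_pressureKernel` — **the far-field representation**: if `U ∈ L³`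
  vanishes on `B(a, R)` and off a bounded set, then `Π[U](x) = ∫ K(x-y)(U y) dy` for a.e.
  `x ∈ B(a, R')`, `R' < R` (approximate `U` in `L³` by test fields with the same support
  constraints; their normalised pressures are the kernel integrals and converge to `Π[U]` in
  `L^{3/2}`);
* `abs_integral_pressureKernel_sub_le` — **the two-centre bound**
  `|F(x) - F(a)| ≤ C |x-a| ∫ |U|²/|y-a|⁴` for `F(x) = ∫ K(x-y)(U y) dy`, `U = 0` on `B(a, 2r)`,
  `x ∈ B(a, r)` (the tree's Hörmander bound `exists_abs_pressureKernel_sub_le`), the form in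
  which (15.35) is used.

## Mathlib / tree

Tree: `rieszPressure`, `isRieszPressureOf_rieszPressure`, `memLp_rieszPressure`,
`integral_rieszPressure_mul_laplacian`, `exists_smooth_seq_tendsto_eLpNorm_three`
(`RieszPressureL3`); `normalisedPressure_eq`, `pressureKernel`, `truncatedPressureIntegral`
(`NormalisedPressure`); `integrableOn_pressureKernel_compl_closedBall`, `abs_pressureKernel_sub_le`
(`NormalisedPressurePV`); `abs_pressureKernel_le`, `measurable_pressureKernel`
(`TaoEnergyLocalisationPressure`); `ae_eq_zero_of_forall_integral_laplacian_mul_inner_eq_zero`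
(`DivCurlAnnihilator`); `exists_abs_pressureKernel_sub_le` (`LocalPressureFarFieldTools`).
Mathlib: `tendstoInMeasure_of_tendsto_eLpNorm`, `TendstoInMeasure.exists_seq_tendsto_ae`,
`tendsto_integral_of_L1`, `ENNReal.lintegral_prod_norm_pow_le`, `ContDiffBump`.

## References

* J. C. Robinson, J. L. Rodrigo, W. Sadowski, *The three-dimensional Navier–Stokes equations*,
  Cambridge Studies in Advanced Mathematics 157 (2016), proof of Lemma 15.12, pp. 232–233,
  (15.34)–(15.35). [RobinsonRodrigoSadowski2016]
* E. M. Stein, *Singular integrals and differentiability properties of functions* (1970),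
  Ch. II §4.2 Thm. 3, Ch. III §1. [Stein1971]
-/

noncomputable section

open MeasureTheory TopologicalSpace Set Function Filter Topology Metric
open scoped ENNReal NNReal RealInnerProductSpace Laplacian

namespace Literature.Analysis.FluidPDE

/-! ### Weyl–Liouville for scalar `L^q` functions and uniqueness of the Riesz pressure -/

section Liouville

/-- **Weyl–Liouville for scalar functions**: a weakly harmonic `Q ∈ L^q(ℝ³)`, `1 < q < ∞`
(`∫ Q Δφ = 0` for all test functions `φ`) vanishes a.e. (apply the tree's vector-valued
Weyl–Liouville lemma to the field `Q e₀` for a unit vector `e₀`). [folklore] -/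
theorem ae_eq_zero_of_memLp_of_forall_integral_mul_laplacian_eq_zero {q : ℝ≥0∞} (hq : 1 < q)
    (hq' : q < ⊤) {Q : EuclideanSpace ℝ (Fin 3) → ℝ} (hQ : MemLp Q q volume)
    (hharm : ∀ φ : EuclideanSpace ℝ (Fin 3) → ℝ, ContDiff ℝ (⊤ : ℕ∞) φ → HasCompactSupport φ →
      ∫ x, Q x * (Δ φ) x = 0) :
    Q =ᵐ[volume] 0 := by
  obtain ⟨e₀, he₀0⟩ := exists_ne (0 : EuclideanSpace ℝ (Fin 3))
  set w : EuclideanSpace ℝ (Fin 3) → EuclideanSpace ℝ (Fin 3) := fun x => Q x • e₀ with hw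
  have hwm : AEStronglyMeasurable w volume := hQ.1.smul_const e₀
  have hwLp : MemLp w q volume := by
    refine MemLp.of_le (hQ.const_mul ‖e₀‖) hwm (Eventually.of_forall fun x => ?_)
    rw [hw]
    dsimp only
    rw [norm_smul, Real.norm_eq_abs, Real.norm_eq_abs, abs_mul, abs_norm, mul_comm]
  have hz : MemLp (0 : EuclideanSpace ℝ (Fin 3) → EuclideanSpace ℝ (Fin 3)) q volume :=
    MemLp.zero
  have key : ∀ θ : EuclideanSpace ℝ (Fin 3) → ℝ,
      FunctionSpaces.IsTestFunctionOn (⊤ : Opens (EuclideanSpace ℝ (Fin 3))) θ →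
      ∀ a : EuclideanSpace ℝ (Fin 3), ∫ x, (Δ θ) x * ⟪(w + 0) x, a⟫ = 0 := by
    intro θ hθ a
    have e : (fun x => (Δ θ) x * ⟪(w + 0) x, a⟫) = fun x => ⟪e₀, a⟫ * (Q x * (Δ θ) x) := by
      funext x
      simp only [hw, Pi.add_apply, Pi.zero_apply, add_zero, inner_smul_left, RCLike.conj_to_real]
      ring
    rw [e, integral_const_mul, hharm θ hθ.contDiff hθ.hasCompactSupport, mul_zero]
  have h := ae_eq_zero_of_forall_integral_laplacian_mul_inner_eq_zero hq hq' hq hq' hwLp hz key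
  filter_upwards [h] with x hx
  have hx' : Q x • e₀ = 0 := by simpa [hw] using hx
  rcases smul_eq_zero.1 hx' with h1 | h1
  · exact h1
  · exact absurd h1 he₀0

-- nested operator types
set_option maxSynthPendingDepth 3 in
/-- **Uniqueness of the whole-space pressure**: if `R ∈ L^{3/2}(ℝ³)` solves the weak Poisson
equation `∫ R Δφ = -∫ D²φ(w, w)` of a field `w ∈ L³`, then `R = Π[w]` a.e. (the difference is a
weakly harmonic `L^{3/2}` function). [cite: Stein1971, Ch. III §1 (Riesz transforms)] -/
theorem ae_eq_rieszPressure_of_forall_integral_mul_laplacian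
    {w : EuclideanSpace ℝ (Fin 3) → EuclideanSpace ℝ (Fin 3)} (hw : MemLp w 3 volume)
    {R : EuclideanSpace ℝ (Fin 3) → ℝ} (hR : MemLp R (3 / 2 : ℝ≥0∞) volume)
    (hReq : ∀ φ : EuclideanSpace ℝ (Fin 3) → ℝ, ContDiff ℝ (⊤ : ℕ∞) φ → HasCompactSupport φ →
      ∫ x, R x * (Δ φ) x = -∫ x, fderiv ℝ (fderiv ℝ φ) x (w x) (w x)) :
    R =ᵐ[volume] rieszPressure w := by
  have h32_1 : (1 : ℝ≥0∞) < 3 / 2 :=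
    (ENNReal.lt_div_iff_mul_lt (Or.inl (by norm_num)) (Or.inl (by norm_num))).2 (by norm_num)
  have h32_top : (3 / 2 : ℝ≥0∞) < ⊤ := ENNReal.div_lt_top ENNReal.ofNat_ne_top two_ne_zero
  have hP := memLp_rieszPressure hw
  set Q : EuclideanSpace ℝ (Fin 3) → ℝ := fun x => R x - rieszPressure w x with hQ
  have hQm : MemLp Q (3 / 2 : ℝ≥0∞) volume := hR.sub hP
  -- integrability of the pairings with `Δφ`
  have hint : ∀ {G : EuclideanSpace ℝ (Fin 3) → ℝ}, MemLp G (3 / 2 : ℝ≥0∞) volume →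
      ∀ {φ : EuclideanSpace ℝ (Fin 3) → ℝ}, ContDiff ℝ (⊤ : ℕ∞) φ → HasCompactSupport φ →
      Integrable (fun x => G x * (Δ φ) x) := by
    intro G hG φ hφ hφc
    have hφ2 : ContDiff ℝ 2 φ := contDiff_infty.1 hφ 2
    have hΔc : Continuous (Δ φ) := continuous_laplacian hφ2
    have hΔ0 : ∀ x ∉ tsupport φ, Δ φ x = 0 := fun x hx => laplacian_eq_zero_of_notMem_tsupport hx
    have hGi : IntegrableOn G (tsupport φ) volume :=
      (hG.locallyIntegrable h32_1.le).integrableOn_isCompact hφc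
    have h1 := integrable_mul_of_eq_zero_off_compact hφc hΔc hΔ0 hGi
    simpa only [mul_comm] using h1
  have hharm : ∀ φ : EuclideanSpace ℝ (Fin 3) → ℝ, ContDiff ℝ (⊤ : ℕ∞) φ → HasCompactSupport φ →
      ∫ x, Q x * (Δ φ) x = 0 := by
    intro φ hφ hφc
    have e : (fun x => Q x * (Δ φ) x) = fun x => R x * (Δ φ) x - rieszPressure w x * (Δ φ) x := by
      funext x; simp only [hQ, sub_mul]
    rw [e, integral_sub (hint hR hφ hφc) (hint hP hφ hφc), hReq φ hφ hφc,
      integral_rieszPressure_mul_laplacian hw hφ hφc, sub_self]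
  have h0 := ae_eq_zero_of_memLp_of_forall_integral_mul_laplacian_eq_zero h32_1 h32_top hQm hharm
  filter_upwards [h0] with x hx
  simpa [hQ, sub_eq_zero] using hx

-- nested operator types
set_option maxSynthPendingDepth 3 in
/-- The Hessian quadratic form of a test function paired with an `L³` field is integrable
(`|D²φ(U,U)| ≤ ‖D²φ‖ |U|²`, `|U|² ∈ L¹_loc`). [folklore] -/
theorem integrable_hessian_apply_of_memLp_three
    {U : EuclideanSpace ℝ (Fin 3) → EuclideanSpace ℝ (Fin 3)} (hU : MemLp U 3 volume)
    {φ : EuclideanSpace ℝ (Fin 3) → ℝ} (hφ : ContDiff ℝ (⊤ : ℕ∞) φ) (hφc : HasCompactSupport φ) :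
    Integrable (fun x => fderiv ℝ (fderiv ℝ φ) x (U x) (U x)) := by
  have hφ2 : ContDiff ℝ 2 φ := contDiff_infty.1 hφ 2
  have hHc : Continuous (fderiv ℝ (fderiv ℝ φ)) :=
    (hφ2.fderiv_right (m := 1) (by norm_num)).continuous_fderiv one_ne_zero
  have hH0 : ∀ x ∉ tsupport φ, fderiv ℝ (fderiv ℝ φ) x = 0 := fun x hx =>
    fderiv_fderiv_eq_zero_of_notMem_tsupport hx
  haveI : IsFiniteMeasure (volume.restrict (tsupport φ)) :=
    ⟨by rw [Measure.restrict_apply_univ]; exact hφc.measure_lt_top⟩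
  have hU2 : MemLp U 2 (volume.restrict (tsupport φ)) :=
    (hU.restrict (tsupport φ)).mono_exponent (by norm_num)
  have hU2i : IntegrableOn (fun x => ‖U x‖ ^ 2) (tsupport φ) volume :=
    (memLp_two_iff_integrable_sq_norm hU2.1).1 hU2
  exact integrable_bilin_apply_self_of_eq_zero_off_compact hφc hHc hH0
    (hU.1.mono_measure Measure.restrict_le_self) hU2i

-- nested operator types
set_option maxSynthPendingDepth 3 in
/-- **Additivity of the Riesz pressure over disjointly supported fields**: if `U₁, U₂ ∈ L³` have
pointwise disjoint supports (`U₁ y = 0 ∨ U₂ y = 0` for every `y`) and `U = U₁ + U₂` a.e., then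
`Π[U] = Π[U₁] + Π[U₂]` a.e.: the tensor splits, `D²φ(U,U) = D²φ(U₁,U₁) + D²φ(U₂,U₂)`, so
`Π[U₁] + Π[U₂]` solves the weak Poisson equation of `U` (the split `p₁ = p₁,₁ + p₁,₂` of
Robinson–Rodrigo–Sadowski's proof of Lemma 15.12, p. 232). [cite: RobinsonRodrigoSadowski2016, proof of Lemma 15.12 p. 232] -/
theorem rieszPressure_add_ae_eq_of_disjoint
    {U U₁ U₂ : EuclideanSpace ℝ (Fin 3) → EuclideanSpace ℝ (Fin 3)} (hU : MemLp U 3 volume)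
    (hU₁ : MemLp U₁ 3 volume) (hU₂ : MemLp U₂ 3 volume) (hdisj : ∀ y, U₁ y = 0 ∨ U₂ y = 0)
    (hsum : U =ᵐ[volume] U₁ + U₂) :
    rieszPressure U =ᵐ[volume] fun x => rieszPressure U₁ x + rieszPressure U₂ x := by
  have hP₁ := memLp_rieszPressure hU₁
  have hP₂ := memLp_rieszPressure hU₂
  have h32_1 : (1 : ℝ≥0∞) < 3 / 2 :=
    (ENNReal.lt_div_iff_mul_lt (Or.inl (by norm_num)) (Or.inl (by norm_num))).2 (by norm_num)
  have hint : ∀ {G : EuclideanSpace ℝ (Fin 3) → ℝ}, MemLp G (3 / 2 : ℝ≥0∞) volume →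
      ∀ {φ : EuclideanSpace ℝ (Fin 3) → ℝ}, ContDiff ℝ (⊤ : ℕ∞) φ → HasCompactSupport φ →
      Integrable (fun x => G x * (Δ φ) x) := by
    intro G hG φ hφ hφc
    have hφ2 : ContDiff ℝ 2 φ := contDiff_infty.1 hφ 2
    have hΔc : Continuous (Δ φ) := continuous_laplacian hφ2
    have hΔ0 : ∀ x ∉ tsupport φ, Δ φ x = 0 := fun x hx => laplacian_eq_zero_of_notMem_tsupport hx
    have hGi : IntegrableOn G (tsupport φ) volume :=
      (hG.locallyIntegrable h32_1.le).integrableOn_isCompact hφc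
    have h1 := integrable_mul_of_eq_zero_off_compact hφc hΔc hΔ0 hGi
    simpa only [mul_comm] using h1
  have hsol : ∀ φ : EuclideanSpace ℝ (Fin 3) → ℝ, ContDiff ℝ (⊤ : ℕ∞) φ → HasCompactSupport φ →
      ∫ x, (rieszPressure U₁ x + rieszPressure U₂ x) * (Δ φ) x =
        -∫ x, fderiv ℝ (fderiv ℝ φ) x (U x) (U x) := by
    intro φ hφ hφc
    have e : (fun x => (rieszPressure U₁ x + rieszPressure U₂ x) * (Δ φ) x) =
        fun x => rieszPressure U₁ x * (Δ φ) x + rieszPressure U₂ x * (Δ φ) x := by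
      funext x; ring
    rw [e, integral_add (hint hP₁ hφ hφc) (hint hP₂ hφ hφc),
      integral_rieszPressure_mul_laplacian hU₁ hφ hφc,
      integral_rieszPressure_mul_laplacian hU₂ hφ hφc, ← neg_add,
      ← integral_add (integrable_hessian_apply_of_memLp_three hU₁ hφ hφc)
        (integrable_hessian_apply_of_memLp_three hU₂ hφ hφc)]
    congr 1
    refine integral_congr_ae ?_
    filter_upwards [hsum] with x hx
    rw [hx, Pi.add_apply]
    rcases hdisj x with h0 | h0
    · simp [h0]
    · simp [h0]
  exact (ae_eq_rieszPressure_of_forall_integral_mul_laplacian hU (hP₁.add hP₂) hsol).symm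

end Liouville

/-! ### The normalised pressure of a field vanishing near the point -/

section Vanish

variable {w : EuclideanSpace ℝ (Fin 3) → EuclideanSpace ℝ (Fin 3)} {x : EuclideanSpace ℝ (Fin 3)}
  {δ : ℝ}

/-- If a continuous finite-energy field vanishes on `B(x, δ)`, its truncated pressure integrals
at `x` of radius `ε < δ` all equal the honest integral `∫ K(x-y)(w y) dy`. [folklore] -/
theorem truncatedPressureIntegral_eq_integral_of_eqOn_ball (h0 : ∀ y ∈ ball x δ, w y = 0)
    {ε : ℝ} (hεδ : ε < δ) :
    truncatedPressureIntegral w x ε = ∫ y, pressureKernel (x - y) (w y) := by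
  rw [truncatedPressureIntegral]
  refine setIntegral_eq_integral_of_forall_compl_eq_zero fun y hy => ?_
  have hy' : y ∈ closedBall x ε := not_notMem.1 hy
  have hyδ : y ∈ ball x δ := by
    rw [mem_closedBall] at hy'
    rw [mem_ball]
    linarith
  rw [h0 y hyδ, pressureKernel_zero_right]

/-- **The principal value of a field vanishing near `x` is the honest integral**: for `w`
continuous with `∫ |w|² < ∞` and `w = 0` on `B(x, δ)`, `HasPressurePV w x (∫ K(x-y)(w y) dy)`
(the truncations are eventually constant). [folklore] -/
theorem hasPressurePV_of_eqOn_ball (hw : Continuous w) (hw2 : Integrable fun y => ‖w y‖ ^ 2)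
    (hδ : 0 < δ) (h0 : ∀ y ∈ ball x δ, w y = 0) :
    HasPressurePV w x (∫ y, pressureKernel (x - y) (w y)) := by
  refine ⟨?_, ?_⟩
  · exact eventually_nhdsWithin_of_forall fun ε hε =>
      integrableOn_pressureKernel_compl_closedBall hw hw2 x hε
  · refine (tendsto_const_nhds (x := ∫ y, pressureKernel (x - y) (w y))).congr' ?_
    filter_upwards [Ioo_mem_nhdsGT hδ] with ε hε
    exact (truncatedPressureIntegral_eq_integral_of_eqOn_ball h0 hε.2).symm

/-- **`p̃[w](x) = ∫ K(x-y)(w y) dy`** for a continuous finite-energy field vanishing on a ball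
about `x` (no principal value, no local term). [folklore] -/
theorem normalisedPressure_eq_integral_of_eqOn_ball (hw : Continuous w)
    (hw2 : Integrable fun y => ‖w y‖ ^ 2) (hδ : 0 < δ) (h0 : ∀ y ∈ ball x δ, w y = 0) :
    normalisedPressure w x = ∫ y, pressureKernel (x - y) (w y) := by
  rw [normalisedPressure_eq (hasPressurePV_of_eqOn_ball hw hw2 hδ h0), h0 x (mem_ball_self hδ),
    norm_zero, zero_pow two_ne_zero, neg_zero, zero_div, zero_add]

end Vanish

/-! ### Kernel integrals along `L³`-convergent sequences -/

section KernelLimit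

/-- Three-factor Hölder with exponents `(3, 3, 3)`:
`∫ f g h ≤ ‖f‖₃ ‖g‖₃ ‖h‖₃` for `ℝ≥0∞`-valued functions. [folklore] -/
theorem lintegral_mul_mul_le_L3 {α : Type*} [MeasurableSpace α] {μ : Measure α}
    {f g h : α → ℝ≥0∞} (hf : AEMeasurable f μ) (hg : AEMeasurable g μ) (hh : AEMeasurable h μ) :
    ∫⁻ a, f a * g a * h a ∂μ ≤
      (∫⁻ a, f a ^ (3 : ℝ) ∂μ) ^ (1 / 3 : ℝ) * (∫⁻ a, g a ^ (3 : ℝ) ∂μ) ^ (1 / 3 : ℝ) *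
        (∫⁻ a, h a ^ (3 : ℝ) ∂μ) ^ (1 / 3 : ℝ) := by
  have hpq : Real.HolderConjugate (3 / 2 : ℝ) 3 := ⟨by norm_num, by norm_num, by norm_num⟩
  have h1 := ENNReal.lintegral_mul_le_Lp_mul_Lq μ hpq (hf.mul hg) hh
  have h2 := ENNReal.lintegral_Lp_mul_le_Lq_mul_Lr (p := (3 / 2 : ℝ)) (q := 3) (r := 3)
    (by norm_num) (by norm_num) (by norm_num) μ hf hg
  calc ∫⁻ a, f a * g a * h a ∂μ = ∫⁻ a, (f * g) a * h a ∂μ := rfl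
    _ ≤ (∫⁻ a, (f * g) a ^ (3 / 2 : ℝ) ∂μ) ^ (1 / (3 / 2 : ℝ)) *
          (∫⁻ a, h a ^ (3 : ℝ) ∂μ) ^ (1 / (3 : ℝ)) := h1
    _ ≤ (∫⁻ a, f a ^ (3 : ℝ) ∂μ) ^ (1 / (3 : ℝ)) * (∫⁻ a, g a ^ (3 : ℝ) ∂μ) ^ (1 / (3 : ℝ)) *
          (∫⁻ a, h a ^ (3 : ℝ) ∂μ) ^ (1 / (3 : ℝ)) := by
        gcongr

variable {v : ℕ → EuclideanSpace ℝ (Fin 3) → EuclideanSpace ℝ (Fin 3)}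
  {U : EuclideanSpace ℝ (Fin 3) → EuclideanSpace ℝ (Fin 3)}

/-- Measurability of `y ↦ K(x-y)(w y)`. [folklore] -/
theorem aestronglyMeasurable_pressureKernel_sub_apply
    {w : EuclideanSpace ℝ (Fin 3) → EuclideanSpace ℝ (Fin 3)} (hw : AEStronglyMeasurable w volume)
    (x : EuclideanSpace ℝ (Fin 3)) :
    AEStronglyMeasurable (fun y => pressureKernel (x - y) (w y)) volume := by
  have h3 : AEMeasurable (fun y : EuclideanSpace ℝ (Fin 3) => (x - y, w y)) volume :=
    (measurable_const.sub measurable_id).aemeasurable.prodMk hw.aemeasurable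
  exact (measurable_pressureKernel.comp_aemeasurable h3).aestronglyMeasurable

/-- Integrability of `y ↦ K(x-y)(w y)` for `w ∈ L³` vanishing on `B(x, δ)` and off a set `K₀`
of finite measure (`|K(x-y)(w y)| ≤ |w y|²/(2πδ³)` and `|w|² ∈ L¹(K₀)`). [folklore] -/
theorem integrable_pressureKernel_sub_apply
    {w : EuclideanSpace ℝ (Fin 3) → EuclideanSpace ℝ (Fin 3)} (hw : MemLp w 3 volume)
    {x : EuclideanSpace ℝ (Fin 3)} {δ : ℝ} (hδ : 0 < δ) (hwx : ∀ y ∈ ball x δ, w y = 0)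
    {K₀ : Set (EuclideanSpace ℝ (Fin 3))} (hK₀ : volume K₀ < ⊤) (hK₀m : MeasurableSet K₀)
    (hwK : ∀ y ∉ K₀, w y = 0) :
    Integrable (fun y => pressureKernel (x - y) (w y)) := by
  haveI : IsFiniteMeasure (volume.restrict K₀) :=
    ⟨by rw [Measure.restrict_apply_univ]; exact hK₀⟩
  have hw2 : MemLp w 2 (volume.restrict K₀) := (hw.restrict K₀).mono_exponent (by norm_num)
  have hw2i : IntegrableOn (fun y => ‖w y‖ ^ 2) K₀ volume :=
    (memLp_two_iff_integrable_sq_norm hw2.1).1 hw2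
  have hdom : Integrable (fun y => K₀.indicator (fun y => ‖w y‖ ^ 2) y / (2 * Real.pi * δ ^ 3)) :=
    (hw2i.integrable_indicator hK₀m).div_const _
  refine hdom.mono' (aestronglyMeasurable_pressureKernel_sub_apply hw.1 x)
    (Eventually.of_forall fun y => ?_)
  by_cases hy : y ∈ ball x δ
  · rw [hwx y hy, pressureKernel_zero_right, norm_zero]
    exact div_nonneg (indicator_nonneg (fun _ _ => sq_nonneg _) _) (by positivity)
  by_cases hyK : y ∈ K₀
  · rw [indicator_of_mem hyK, Real.norm_eq_abs]
    have hxy : δ ≤ ‖x - y‖ := by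
      rw [mem_ball, dist_eq_norm, not_lt, ← norm_neg, neg_sub] at hy
      exact hy
    calc |pressureKernel (x - y) (w y)| ≤ ‖w y‖ ^ 2 / (2 * Real.pi * ‖x - y‖ ^ 3) :=
          abs_pressureKernel_le _ _
      _ ≤ ‖w y‖ ^ 2 / (2 * Real.pi * δ ^ 3) := by
          gcongr
  · rw [hwK y hyK, pressureKernel_zero_right, norm_zero, indicator_of_notMem hyK, zero_div]

/-- **Kernel integrals pass to `L³` limits away from the supports**: if `vₙ → U` in `L³`, all
these fields vanish on `B(x, δ)` and off a fixed set `K₀` of finite measure, then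
`∫ K(x-y)(vₙ y) dy → ∫ K(x-y)(U y) dy`
(`|K(x-y)(vₙ y) - K(x-y)(U y)| ≤ (|U y| + |vₙ y|)|vₙ y - U y|/(πδ³)` and the three-factor Hölder
inequality with `1_{K₀}`). [folklore] -/
theorem tendsto_integral_pressureKernel_of_tendsto_eLpNorm_three
    (hv : ∀ n, MemLp (v n) 3 volume) (hU : MemLp U 3 volume)
    (hT : Tendsto (fun n => eLpNorm (v n - U) 3 volume) atTop (𝓝 0))
    {x : EuclideanSpace ℝ (Fin 3)} {δ : ℝ} (hδ : 0 < δ) (hvx : ∀ n, ∀ y ∈ ball x δ, v n y = 0)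
    (hUx : ∀ y ∈ ball x δ, U y = 0) {K₀ : Set (EuclideanSpace ℝ (Fin 3))} (hK₀ : volume K₀ < ⊤)
    (hK₀m : MeasurableSet K₀) (hvK : ∀ n, ∀ y ∉ K₀, v n y = 0) (hUK : ∀ y ∉ K₀, U y = 0) :
    Tendsto (fun n => ∫ y, pressureKernel (x - y) (v n y)) atTop
      (𝓝 (∫ y, pressureKernel (x - y) (U y))) := by
  have hiU := integrable_pressureKernel_sub_apply hU hδ hUx hK₀ hK₀m hUK
  have hiv : ∀ n, Integrable (fun y => pressureKernel (x - y) (v n y)) := fun n =>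
    integrable_pressureKernel_sub_apply (hv n) hδ (hvx n) hK₀ hK₀m (hvK n)
  refine tendsto_integral_of_L1 _ hiU.aestronglyMeasurable (Eventually.of_forall hiv) ?_
  -- exponent bookkeeping for `L³`
  have h3 : ∀ (f : EuclideanSpace ℝ (Fin 3) → EuclideanSpace ℝ (Fin 3)),
      (∫⁻ y, ‖f y‖ₑ ^ (3 : ℝ)) ^ (1 / 3 : ℝ) = eLpNorm f 3 volume := fun f => by
    rw [eLpNorm_eq_lintegral_rpow_enorm_toReal (by norm_num) (by norm_num), ENNReal.toReal_ofNat]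
  -- the pointwise bound
  set c : ℝ := (Real.pi * δ ^ 3)⁻¹ with hc
  have hc0 : 0 ≤ c := by positivity
  set χ : EuclideanSpace ℝ (Fin 3) → ℝ≥0∞ := K₀.indicator 1 with hχ
  have hχm : Measurable χ := measurable_one.indicator hK₀m
  have hpt : ∀ n y, ‖pressureKernel (x - y) (v n y) - pressureKernel (x - y) (U y)‖ₑ ≤
      ENNReal.ofReal c * (χ y * (‖U y‖ₑ + ‖v n y‖ₑ) * ‖v n y - U y‖ₑ) := by
    intro n y
    by_cases hy : y ∈ ball x δ
    · rw [hvx n y hy, hUx y hy, sub_self, enorm_zero]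
      exact zero_le
    by_cases hyK : y ∈ K₀
    · have hχy : χ y = 1 := by rw [hχ, indicator_of_mem hyK, Pi.one_apply]
      have hxy : δ ≤ ‖x - y‖ := by
        rw [mem_ball, dist_eq_norm, not_lt, ← norm_neg, neg_sub] at hy
        exact hy
      have hreal : |pressureKernel (x - y) (v n y) - pressureKernel (x - y) (U y)| ≤
          c * ((‖U y‖ + ‖v n y‖) * ‖v n y - U y‖) := by
        calc |pressureKernel (x - y) (v n y) - pressureKernel (x - y) (U y)|
            ≤ (‖U y‖ + ‖v n y‖) * ‖v n y - U y‖ / (Real.pi * ‖x - y‖ ^ 3) :=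
              abs_pressureKernel_sub_le _ _ _
          _ ≤ (‖U y‖ + ‖v n y‖) * ‖v n y - U y‖ / (Real.pi * δ ^ 3) := by
              refine div_le_div_of_nonneg_left (by positivity) (by positivity) ?_
              gcongr
          _ = c * ((‖U y‖ + ‖v n y‖) * ‖v n y - U y‖) := by rw [hc]; ring
      rw [hχy, one_mul, Real.enorm_eq_ofReal_abs, ← ofReal_norm, ← ofReal_norm,
        ← ofReal_norm, ← ENNReal.ofReal_add (norm_nonneg _) (norm_nonneg _),
        ← ENNReal.ofReal_mul (by positivity), ← ENNReal.ofReal_mul hc0]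
      exact ENNReal.ofReal_le_ofReal hreal
    · rw [hvK n y hyK, hUK y hyK, sub_self, enorm_zero]
      exact zero_le
  -- the Hölder bound for the `L¹` distance
  set T : ℕ → ℝ≥0∞ := fun n => eLpNorm (v n - U) 3 volume with hTdef
  set A : ℝ≥0∞ := eLpNorm U 3 volume with hA
  have hAt : A ≠ ⊤ := hU.eLpNorm_ne_top
  set V : ℝ≥0∞ := volume K₀ with hV
  have hbound : ∀ n, ∫⁻ y, ‖pressureKernel (x - y) (v n y) - pressureKernel (x - y) (U y)‖ₑ ≤
      ENNReal.ofReal c * (V ^ (1 / 3 : ℝ) * (A + (T n + A)) * T n) := by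
    intro n
    have hFm : AEMeasurable (fun y => ‖U y‖ₑ + ‖v n y‖ₑ) volume :=
      hU.1.enorm.add (hv n).1.enorm
    have hGm : AEMeasurable (fun y => ‖v n y - U y‖ₑ) volume := ((hv n).1.sub hU.1).enorm
    calc ∫⁻ y, ‖pressureKernel (x - y) (v n y) - pressureKernel (x - y) (U y)‖ₑ
        ≤ ∫⁻ y, ENNReal.ofReal c * (χ y * (‖U y‖ₑ + ‖v n y‖ₑ) * ‖v n y - U y‖ₑ) :=
          lintegral_mono (hpt n)
      _ = ENNReal.ofReal c * ∫⁻ y, χ y * (‖U y‖ₑ + ‖v n y‖ₑ) * ‖v n y - U y‖ₑ := by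
          rw [lintegral_const_mul' _ _ ENNReal.ofReal_ne_top]
      _ ≤ ENNReal.ofReal c * ((∫⁻ y, χ y ^ (3 : ℝ)) ^ (1 / 3 : ℝ) *
            (∫⁻ y, (‖U y‖ₑ + ‖v n y‖ₑ) ^ (3 : ℝ)) ^ (1 / 3 : ℝ) *
            (∫⁻ y, ‖v n y - U y‖ₑ ^ (3 : ℝ)) ^ (1 / 3 : ℝ)) := by
          gcongr
          exact lintegral_mul_mul_le_L3 hχm.aemeasurable hFm hGm
      _ ≤ ENNReal.ofReal c * (V ^ (1 / 3 : ℝ) * (A + (T n + A)) * T n) := by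
          gcongr
          · -- `∫ χ³ = |K₀|`
            have e : (fun y => χ y ^ (3 : ℝ)) = χ := by
              funext y
              by_cases hy : y ∈ K₀
              · rw [hχ, indicator_of_mem hy, Pi.one_apply, ENNReal.one_rpow]
              · rw [hχ, indicator_of_notMem hy, ENNReal.zero_rpow_of_pos (by norm_num)]
            rw [e, hχ, lintegral_indicator_one hK₀m]
          · -- Minkowski: `‖ |U| + |vₙ| ‖₃ ≤ ‖U‖₃ + ‖vₙ‖₃ ≤ ‖U‖₃ + (‖vₙ - U‖₃ + ‖U‖₃)`
            calc (∫⁻ y, (‖U y‖ₑ + ‖v n y‖ₑ) ^ (3 : ℝ)) ^ (1 / 3 : ℝ)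
                ≤ (∫⁻ y, ‖U y‖ₑ ^ (3 : ℝ)) ^ (1 / 3 : ℝ) +
                    (∫⁻ y, ‖v n y‖ₑ ^ (3 : ℝ)) ^ (1 / 3 : ℝ) :=
                  ENNReal.lintegral_Lp_add_le hU.1.enorm (hv n).1.enorm (by norm_num)
              _ = A + eLpNorm (v n) 3 volume := by rw [h3, h3]
              _ ≤ A + (T n + A) := by
                  refine add_le_add le_rfl ?_
                  have e : v n = (v n - U) + U := by abel
                  calc eLpNorm (v n) 3 volume = eLpNorm ((v n - U) + U) 3 volume := by rw [← e]
                    _ ≤ eLpNorm (v n - U) 3 volume + eLpNorm U 3 volume :=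
                        eLpNorm_add_le ((hv n).1.sub hU.1) hU.1 (by norm_num)
          · rw [h3]
            exact le_of_eq rfl
  -- the right-hand side tends to `0`
  have hlim : Tendsto (fun n => ENNReal.ofReal c * (V ^ (1 / 3 : ℝ) * (A + (T n + A)) * T n))
      atTop (𝓝 0) := by
    have hVt : V ^ (1 / 3 : ℝ) ≠ ⊤ := ENNReal.rpow_ne_top_of_nonneg (by norm_num) hK₀.ne
    have h1 : Tendsto (fun n => A + (T n + A)) atTop (𝓝 (A + (0 + A))) :=
      tendsto_const_nhds.add (hT.add tendsto_const_nhds)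
    have h2 : Tendsto (fun n => V ^ (1 / 3 : ℝ) * (A + (T n + A))) atTop
        (𝓝 (V ^ (1 / 3 : ℝ) * (A + (0 + A)))) :=
      ENNReal.Tendsto.const_mul h1 (Or.inr hVt)
    have hfin : V ^ (1 / 3 : ℝ) * (A + (0 + A)) ≠ ⊤ :=
      ENNReal.mul_ne_top hVt (by rw [zero_add]; exact ENNReal.add_ne_top.2 ⟨hAt, hAt⟩)
    have h3' : Tendsto (fun n => V ^ (1 / 3 : ℝ) * (A + (T n + A)) * T n) atTop
        (𝓝 (V ^ (1 / 3 : ℝ) * (A + (0 + A)) * 0)) :=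
      ENNReal.Tendsto.mul h2 (Or.inr ENNReal.zero_ne_top) hT (Or.inr hfin)
    rw [mul_zero] at h3'
    have h4 := ENNReal.Tendsto.const_mul (a := ENNReal.ofReal c) h3' (Or.inr ENNReal.ofReal_ne_top)
    rwa [mul_zero] at h4
  exact tendsto_of_tendsto_of_tendsto_of_le_of_le tendsto_const_nhds hlim
    (fun _ => zero_le) hbound

end KernelLimit

/-! ### The far-field representation of the Riesz pressure -/

section FarField

variable {U : EuclideanSpace ℝ (Fin 3) → EuclideanSpace ℝ (Fin 3)} {a : EuclideanSpace ℝ (Fin 3)}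
  {R R' R₁ : ℝ}

-- nested operator types
set_option maxSynthPendingDepth 3 in
/-- **Far-field representation of the Riesz pressure** (the kernel formula
`p₁,₂(x) = ∫_{|y|>2r} [∂ᵢ∂ⱼΓ(x-y)] uᵢuⱼ dy` of Robinson–Rodrigo–Sadowski 2016, p. 232, for the
whole-space pressure of the far part of the field). Let `U ∈ L³(ℝ³; ℝ³)` vanish on the ball
`B(a, R)` and outside the closed ball `B̄(a, R₁)`. Then for `0 < R' < R`,
`Π[U](x) = ∫ K(x-y)(U y) dy` for a.e. `x ∈ B(a, R')`, `K(z)(b) = (3⟨z,b⟩² - |b|²|z|²)/(4π|z|⁵)`.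
Proof: approximate `U` in `L³` by test fields `vₙ` vanishing on `B̄(a, (R+R')/2)` and supported
in `B(a, max(R₁,1) + 1)` (cut-offs of any test-field approximants); `p̃[vₙ] → Π[U]` in `L^{3/2}`
(`IsRieszPressureOf`), hence a.e. along a subsequence, while
`p̃[vₙ](x) = ∫ K(x-y)(vₙ y) dy → ∫ K(x-y)(U y) dy` for every `x ∈ B(a, R')`.
[cite: RobinsonRodrigoSadowski2016, proof of Lemma 15.12 p. 232] -/
theorem rieszPressure_ae_eq_integral_pressureKernel (hU : MemLp U 3 volume) (hR' : 0 < R')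
    (hR'R : R' < R) (hvan : ∀ y ∈ ball a R, U y = 0) (hout : ∀ y ∉ closedBall a R₁, U y = 0) :
    ∀ᵐ x ∂(volume.restrict (ball a R')),
      rieszPressure U x = ∫ y, pressureKernel (x - y) (U y) := by
  -- radii
  set δ : ℝ := (R - R') / 2 with hδ
  have hδ0 : 0 < δ := by rw [hδ]; linarith
  set R₂ : ℝ := max R₁ 1 with hR₂
  have hR₂0 : 0 < R₂ := lt_max_of_lt_right one_pos
  have hout' : ∀ y ∉ closedBall a R₂, U y = 0 := fun y hy =>
    hout y fun h => hy (closedBall_subset_closedBall (le_max_left _ _) h)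
  -- the two cut-offs
  have hb₁r : 0 < R - δ := by rw [hδ]; linarith
  have hb₁r' : R - δ < R - δ / 2 := by linarith
  obtain ⟨b₁, hb₁i, hb₁o⟩ : ∃ b : ContDiffBump a, b.rIn = R - δ ∧ b.rOut = R - δ / 2 :=
    ⟨⟨R - δ, R - δ / 2, hb₁r, hb₁r'⟩, rfl, rfl⟩
  obtain ⟨b₂, hb₂i, hb₂o⟩ : ∃ b : ContDiffBump a, b.rIn = R₂ ∧ b.rOut = R₂ + 1 :=
    ⟨⟨R₂, R₂ + 1, hR₂0, by linarith⟩, rfl, rfl⟩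
  set χ : EuclideanSpace ℝ (Fin 3) → ℝ := fun y => (1 - b₁ y) * b₂ y with hχ
  have hχs : ContDiff ℝ (⊤ : ℕ∞) χ := (contDiff_const.sub b₁.contDiff).mul b₂.contDiff
  have hχ1 : ∀ y, |χ y| ≤ 1 := fun y => by
    rw [hχ, abs_mul, abs_of_nonneg (sub_nonneg.2 (b₁.le_one)), abs_of_nonneg (b₂.nonneg)]
    exact mul_le_one₀ (sub_le_self _ (b₁.nonneg)) (b₂.nonneg) (b₂.le_one)
  have hχU : ∀ y, χ y • U y = U y := by
    intro y
    by_cases hy : y ∈ ball a R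
    · rw [hvan y hy, smul_zero]
    · have h1 : b₁ y = 0 := by
        apply b₁.zero_of_le_dist
        rw [mem_ball, not_lt] at hy
        rw [hb₁o]
        linarith
      by_cases hy2 : y ∈ closedBall a R₂
      · have h2 : b₂ y = 1 := b₂.one_of_mem_closedBall (by rw [hb₂i]; exact hy2)
        rw [hχ]; dsimp only; rw [h1, h2, sub_zero, one_mul, one_smul]
      · rw [hout' y hy2, smul_zero]
  have hχ0 : ∀ y ∈ closedBall a (R - δ), χ y = 0 := fun y hy => by
    rw [hχ]; dsimp only
    rw [b₁.one_of_mem_closedBall (by rw [hb₁i]; exact hy), sub_self, zero_mul]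
  have hχK : ∀ y ∉ ball a (R₂ + 1), χ y = 0 := fun y hy => by
    have h2 : b₂ y = 0 := by
      apply b₂.zero_of_le_dist
      rw [mem_ball, not_lt] at hy
      rw [hb₂o]
      exact hy
    rw [hχ]; dsimp only; rw [h2, mul_zero]
  -- the approximating test fields
  obtain ⟨g, hg, hgT⟩ := exists_smooth_seq_tendsto_eLpNorm_three hU
  set v : ℕ → EuclideanSpace ℝ (Fin 3) → EuclideanSpace ℝ (Fin 3) := fun n y => χ y • g n y
    with hv
  have hvs : ∀ n, ContDiff ℝ (⊤ : ℕ∞) (v n) ∧ HasCompactSupport (v n) := fun n =>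
    ⟨hχs.smul (hg n).1, (hg n).2.smul_left (f := χ) (f' := g n)⟩
  have hv3 : ∀ n, MemLp (v n) 3 volume := fun n =>
    (hvs n).1.continuous.memLp_of_hasCompactSupport (hvs n).2
  have hvT : Tendsto (fun n => eLpNorm (v n - U) 3 volume) atTop (𝓝 0) := by
    refine tendsto_of_tendsto_of_tendsto_of_le_of_le tendsto_const_nhds hgT
      (fun _ => zero_le) fun n => ?_
    refine eLpNorm_mono fun y => ?_
    have e : (v n - U) y = χ y • (g n - U) y := by
      simp only [hv, Pi.sub_apply, smul_sub, hχU y]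
    rw [e, norm_smul, Real.norm_eq_abs]
    exact mul_le_of_le_one_left (norm_nonneg _) (hχ1 y)
  have hvx0 : ∀ n, ∀ y ∈ closedBall a (R - δ), v n y = 0 := fun n y hy => by
    simp only [hv, hχ0 y hy, zero_smul]
  have hvK : ∀ n, ∀ y ∉ ball a (R₂ + 1), v n y = 0 := fun n y hy => by
    simp only [hv, hχK y hy, zero_smul]
  have hUK : ∀ y ∉ ball a (R₂ + 1), U y = 0 := fun y hy =>
    hout' y fun h => hy (closedBall_subset_ball (by linarith) h)
  -- `p̃[vₙ] → Π[U]` in `L^{3/2}`, hence a.e. along a subsequence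
  have hE := (isRieszPressureOf_rieszPressure hU).2.2 v hvs hvT
  have hPm : ∀ n, AEStronglyMeasurable (normalisedPressure (v n)) volume := fun n =>
    (memLp_normalisedPressure_three_halves (hvs n).1 (hvs n).2).1
  have hIM := tendstoInMeasure_of_tendsto_eLpNorm (by norm_num) hPm
    (aestronglyMeasurable_rieszPressure hU) hE
  obtain ⟨ns, hns, hae⟩ := hIM.exists_seq_tendsto_ae
  -- the pointwise statement on `B(a, R')`
  have hpt : ∀ x ∈ ball a R', Tendsto (fun i => normalisedPressure (v (ns i)) x) atTop
      (𝓝 (∫ y, pressureKernel (x - y) (U y))) := by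
    intro x hx
    have hxδ : ball x δ ⊆ closedBall a (R - δ) := by
      intro y hy
      rw [mem_ball] at hx hy
      rw [mem_closedBall]
      have : dist y a ≤ dist y x + dist x a := dist_triangle _ _ _
      have e : R' + δ = R - δ := by rw [hδ]; ring
      linarith
    have hvx : ∀ n, ∀ y ∈ ball x δ, v n y = 0 := fun n y hy => hvx0 n y (hxδ hy)
    have hUx : ∀ y ∈ ball x δ, U y = 0 := fun y hy =>
      hvan y (closedBall_subset_ball (by linarith) (hxδ hy))
    have hrepr : ∀ n, normalisedPressure (v n) x = ∫ y, pressureKernel (x - y) (v n y) := fun n =>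
      normalisedPressure_eq_integral_of_eqOn_ball (hvs n).1.continuous
        (integrable_norm_sq_of_hasCompactSupport (hvs n).1.continuous (hvs n).2) hδ0 (hvx n)
    have hlim := tendsto_integral_pressureKernel_of_tendsto_eLpNorm_three hv3 hU hvT hδ0 hvx hUx
      measure_ball_lt_top measurableSet_ball hvK hUK
    simp_rw [hrepr]
    exact hlim.comp hns.tendsto_atTop
  rw [ae_restrict_iff' measurableSet_ball]
  filter_upwards [hae] with x hx hxB
  exact tendsto_nhds_unique hx (hpt x hxB)

/-- **The two-centre bound for the far-field integral** (the estimate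
`‖∇p₁,₂‖_{L^∞(B_r)} ≤ 16c ∫_{2r<|y|<ρ} |u|²/|y|⁴ dy`, "since `|x - y| > |y|/2` for `|x| < r` and
`|y| > 2r`", Robinson–Rodrigo–Sadowski 2016, (15.35), in mean-value form): there is an absolute
`C` such that for `U` vanishing on `B(a, 2r)` with `y ↦ K(x-y)(U y)` and `y ↦ K(a-y)(U y)`
integrable and `x ∈ B(a, r)`,
`|∫ K(x-y)(U y) dy - ∫ K(a-y)(U y) dy| ≤ C |x - a| ∫ |U y|²/|y - a|⁴ dy`.
[cite: RobinsonRodrigoSadowski2016, proof of Lemma 15.12, (15.35) p. 233] -/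
theorem exists_abs_integral_pressureKernel_sub_le :
    ∃ C : ℝ, 0 ≤ C ∧ ∀ (U : EuclideanSpace ℝ (Fin 3) → EuclideanSpace ℝ (Fin 3))
      (a x : EuclideanSpace ℝ (Fin 3)) (r : ℝ), (∀ y ∈ ball a (2 * r), U y = 0) → x ∈ ball a r →
      Integrable (fun y => pressureKernel (x - y) (U y)) →
      Integrable (fun y => pressureKernel (a - y) (U y)) →
      Integrable (fun y => ‖U y‖ ^ 2 / ‖y - a‖ ^ 4) →
      |(∫ y, pressureKernel (x - y) (U y)) - ∫ y, pressureKernel (a - y) (U y)| ≤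
        C * ‖x - a‖ * ∫ y, ‖U y‖ ^ 2 / ‖y - a‖ ^ 4 := by
  obtain ⟨C, hC0, hC⟩ := exists_abs_pressureKernel_sub_le
  refine ⟨C, hC0, fun U a x r hvan hx hix hia hiW => ?_⟩
  rw [← integral_sub hix hia]
  have hpt : ∀ y, |pressureKernel (x - y) (U y) - pressureKernel (a - y) (U y)| ≤
      C * ‖x - a‖ * (‖U y‖ ^ 2 / ‖y - a‖ ^ 4) := by
    intro y
    by_cases hy : y ∈ ball a (2 * r)
    · rw [hvan y hy, pressureKernel_zero_right, pressureKernel_zero_right, sub_self, abs_zero]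
      positivity
    · have hya : 2 * ‖x - a‖ ≤ ‖y - a‖ := by
        rw [mem_ball, dist_eq_norm, not_lt] at hy
        rw [mem_ball, dist_eq_norm] at hx
        linarith
      have hy0 : y ≠ a := by
        intro h
        rw [h, mem_ball, dist_self, not_lt] at hy
        rw [mem_ball] at hx
        linarith [dist_nonneg (x := x) (y := a)]
      calc |pressureKernel (x - y) (U y) - pressureKernel (a - y) (U y)|
          ≤ C * ‖x - a‖ * ‖U y‖ ^ 2 / ‖y - a‖ ^ 4 := hC a x y (U y) hya hy0
        _ = C * ‖x - a‖ * (‖U y‖ ^ 2 / ‖y - a‖ ^ 4) := by ring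
  calc |∫ y, (pressureKernel (x - y) (U y) - pressureKernel (a - y) (U y))|
      ≤ ∫ y, |pressureKernel (x - y) (U y) - pressureKernel (a - y) (U y)| :=
        abs_integral_le_integral_abs
    _ ≤ ∫ y, C * ‖x - a‖ * (‖U y‖ ^ 2 / ‖y - a‖ ^ 4) :=
        integral_mono_of_nonneg (Eventually.of_forall fun y => abs_nonneg _)
          (hiW.const_mul _) (Eventually.of_forall hpt)
    _ = C * ‖x - a‖ * ∫ y, ‖U y‖ ^ 2 / ‖y - a‖ ^ 4 := integral_const_mul _ _

end FarField

end Literature.Analysis.FluidPDE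

end
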